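import Mathlib.Algebra.BigOperators.Finprod
import Summits.ABC.IUTFork.Cor312ProvenanceDH
import HarnessLib

/-!
# [IUTchIII] Cor. 3.12 provenance: the `q`-side identification reduced to ONE LOCAL log-volume identity (c312 crew, wave 2, W2-F companion)

Record-only companion (seat abc-iut-c312-8; board row W2-F); TAKES NO SIDE on Cor. 3.12. The load-bearing field of the provenance
link `Cor312Prov.IsSettingOf D P` is `negLogQ_eq : P.negLogQ = −absLogq D` ([IUTchIV] Thm. 1.10, kurims p. 23 l. 27–30: "the
quantity «`|log(q)|`» defined in [IUTchIII], Corollary 3.12, is equal to `(1/2l)·log(q)`"). On the verbatim side (abc-iut-c312-7's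
`Cor312.Setting`) `−|log(q)| = processionNormalized_{j ∈ 𝔽_l^⋇} Σ_{v_ℚ} qLocal j v_ℚ` — an average over labels of a sum over places
`v_ℚ` of ℚ of LOCAL mono-analytic log-volumes ([IUTchIII] Prop. 3.9 (i)–(iii)); on the datum side `log(q) = (1/[F:ℚ]) Σ_{v ∈ 𝕍(F)^bad}
ord_v(q_v)·log N(v)` (`Cor312Prov.logq`). This file does the BOOKKEEPING between the two shapes, so that whoever assembles the real
setting (c312-7's `Setting.ofComparison` p407164 fed with c312-3's regions and S1/S2's volumes; c312-6's verbatim↔DH agreement) owes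
exactly ONE local identity per `(j, v_ℚ)`:
* `Cor312.Setting.negLogQ_eq_finsum_of_qLocal` — if the local `q`-volumes do not depend on the label `j ∈ 𝔽_l^⋇` (`qLocal j v_ℚ = f v_ℚ`),
  then `−|log(q)| = Σ_{v_ℚ} f v_ℚ` (the procession average of a constant; `l⋇ ≥ 2`);
* `logq_eq_sum_fiberwise` / `absLogq_eq_sum_fiberwise` — `log(q)` and `|log(q)|` regrouped along ANY "place below" map
  `g : FinitePlace F → κ` (e.g. `v ↦ v_ℚ`): `(1/[F:ℚ]) Σ_{j ∈ g(𝕍(F)^bad)} Σ_{v ∈ 𝕍(F)^bad, g v = j} ord_v(q_v)·log N(v)` (Mathlib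
  `Finset.sum_fiberwise_of_maps_to`);
* **`negLogQ_eq_neg_absLogq_of_local`** — THE CRITERION: if for every label `j ∈ 𝔽_l^⋇` and every `v_ℚ`,
  `qLocal j v_ℚ = −(1/(2l·[F:ℚ])) · Σ_{v ∈ 𝕍(F)^bad, g v = v_ℚ} ord_v(q_v)·log N(v)`, then `P.negLogQ = −absLogq D`, i.e. the field
  `IsSettingOf.negLogQ_eq` holds (and with c312-5's real index, `isSettingOf_ofInitial` gives the whole link).
All PROVED; nothing here computes a single log-volume — that is the local content ([IUTchIII] Prop. 3.9 (iii) "global log-volume =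
degree of the arithmetic line bundle"; DH Thm. 3.10.1; S2's conversion formula `log μ̄(a·𝒪) = log|a|`). [claim: Mochizuki2012, status: disputed]
-/

noncomputable section

namespace Summit.ABC.IUTFork

open Literature.IUT.HodgeTheaters Literature.IUT.LogVolume Literature.IUT.LogThetaLattice NumberField

/-! ## 1. The verbatim side: a label-independent local `q`-volume sums to `−|log(q)|` -/

namespace Cor312.Setting

variable {T : Thm311.ThetaIndex} {S : Thm311.Situation T} (P : Cor312.Setting S)

/-- If the local `q`-pilot log-volumes of a Cor. 3.12 setting do not depend on the label `j ∈ 𝔽_l^⋇` — `qLocal j v_ℚ = f v_ℚ`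
(as for the image of the `q`-pilot object, Def. 3.8 (i): the same `q_v` at every label, [IUTchII] Cor. 4.10 (i) "△") — then
`−|log(q)| = Σ_{v_ℚ} f v_ℚ`: the procession-normalization (Prop. 3.9 (i), average over `j ∈ 𝔽_l^⋇`, L6-t4's `processionNormalized`)
of a constant family is that constant (`l⋇ ≥ 2 > 0`). PROVED. [claim: Mochizuki2012, status: disputed] -/
theorem negLogQ_eq_finsum_of_qLocal (f : T.VQ → ℝ) (h : ∀ (i : Fin T.lstar) (vQ : T.VQ), P.qLocal (labelSucc i) vQ = f vQ) :
    P.negLogQ = ∑ᶠ vQ : T.VQ, f vQ := by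
  have hl : 0 < T.lstar := lt_of_lt_of_le (by norm_num) T.two_le_lstar
  unfold negLogQ
  have hfun : (fun i : Fin T.lstar => ∑ᶠ vQ : T.VQ, P.qLocal (labelSucc i) vQ) = fun _ => ∑ᶠ vQ : T.VQ, f vQ := by
    funext i; exact finsum_congr fun vQ => h i vQ
  rw [hfun, processionNormalized_const hl]

end Cor312.Setting

/-! ## 2. The datum side: `log(q)` regrouped along a "place below" map -/

namespace Cor312Prov

universe u v w

variable {F : Type u} {K : Type v} {Fbar : Type w} [Field F] [NumberField F] [Field K] [NumberField K]
  [Algebra F K] [Field Fbar] [Algebra F Fbar] [Algebra K Fbar] {E : WeierstrassCurve F} [E.IsElliptic]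
  {l : ℕ} {Pb : BadPlacePredicates K}

/-- The local term of `log(q)` at a bad place, as a function on `𝕍(F)^bad` (for the regrouping lemmas): `ord_v(q_v)·log N(v)`.
[claim: Mochizuki2012, status: disputed] -/
def qTerm (v : FinitePlace F) : ℝ := (qParamOrd E v.maximalIdeal : ℝ) * logNorm F v.maximalIdeal

/-- `log(q) = (1/[F:ℚ]) Σ_{v ∈ 𝕍(F)^bad} ord_v(q_v)·log N(v)` as a FINITE sum over `𝕍(F)^bad` (finite: `vFbad_finite`). PROVED.
[claim: Mochizuki2012, status: disputed] -/
theorem logq_eq_sum (D : InitialThetaData F K Fbar E l Pb) :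
    logq D = (∑ v ∈ (vFbad_finite D).toFinset, qTerm (E := E) v) / Module.finrank ℚ F := by
  rw [logq_eq_ndeg D (vFbad_finite D), FinDivisor.ndeg_apply, qArithDivisor, FinDivisor.deg_sum_of]
  rfl

/-- **`log(q)` regrouped along any "place below" map** `g : FinitePlace F → κ` (e.g. `v ↦ v_ℚ`, the place of `ℚ` under `v`, or the
residue characteristic): `log(q) = (1/[F:ℚ]) Σ_{j ∈ g(𝕍(F)^bad)} Σ_{v ∈ 𝕍(F)^bad, g v = j} ord_v(q_v)·log N(v)` — the shape of the verbatim
side's `Σ_{v_ℚ} (Σ_{v | v_ℚ} …)`. PROVED (Mathlib `Finset.sum_fiberwise_of_maps_to`). [claim: Mochizuki2012, status: disputed] -/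
theorem logq_eq_sum_fiberwise {κ : Type*} [DecidableEq κ] (D : InitialThetaData F K Fbar E l Pb)
    (g : FinitePlace F → κ) :
    logq D = (∑ j ∈ (vFbad_finite D).toFinset.image g,
      ∑ v ∈ (vFbad_finite D).toFinset with g v = j, qTerm (E := E) v) / Module.finrank ℚ F := by
  rw [logq_eq_sum D, Finset.sum_fiberwise_of_maps_to (fun v hv => Finset.mem_image_of_mem g hv)]

/-- The same regrouping as a `finsum` over ALL `j : κ` (fibres over `j ∉ g(𝕍(F)^bad)` are empty): `log(q) = (1/[F:ℚ]) Σᶠ_j Σ_{v ∈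
𝕍(F)^bad, g v = j} ord_v(q_v)·log N(v)`. PROVED. [claim: Mochizuki2012, status: disputed] -/
theorem logq_eq_finsum_fiberwise {κ : Type*} [DecidableEq κ] (D : InitialThetaData F K Fbar E l Pb)
    (g : FinitePlace F → κ) :
    logq D = (∑ᶠ j : κ, ∑ v ∈ (vFbad_finite D).toFinset with g v = j, qTerm (E := E) v) / Module.finrank ℚ F := by
  rw [logq_eq_sum_fiberwise D g]
  congr 1
  refine (finsum_eq_sum_of_support_subset _ ?_).symm
  intro j hj
  rw [Function.mem_support] at hj
  simp only [Finset.coe_image, Set.mem_image, Finset.mem_coe]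
  by_contra hne
  apply hj
  refine Finset.sum_eq_zero fun v hv => ?_
  rw [Finset.mem_filter] at hv
  exact absurd ⟨v, hv.1, hv.2⟩ hne

/-- **THE CRITERION for `IsSettingOf.negLogQ_eq`.** Let `P` be a Cor. 3.12 setting (c312-7) over an index skeleton `T` and
`g : FinitePlace F → T.VQ` the "place of ℚ below" map used to index packets. If at every label `j ∈ 𝔽_l^⋇` and every `v_ℚ` the local
mono-analytic log-volume of the `q`-pilot image is
`qLocal j v_ℚ = −(Σ_{v ∈ 𝕍(F)^bad, g v = v_ℚ} ord_v(q_v)·log N(v)) / (2l·[F:ℚ])`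
— the local content of [IUTchIII] Prop. 3.9 (iii) / [IUTchIV] p. 23 "`|log(q)| = (1/2l)·log(q)`" (`q̲_v = q_v^{1/2l}`, [IUTchI] Ex. 3.2
(iv)) — then `P.negLogQ = −absLogq D`. PROVED (bookkeeping: §1 + §2). With c312-5's real index this is the only field of
`IsSettingOf D P` not holding by construction (`Cor312ProvenanceReal.isSettingOf_ofInitial`). [claim: Mochizuki2012, status: disputed] -/
theorem negLogQ_eq_neg_absLogq_of_local (D : InitialThetaData F K Fbar E l Pb) {T : Thm311.ThetaIndex} [DecidableEq T.VQ]
    {S : Thm311.Situation T} (P : Cor312.Setting S) (g : FinitePlace F → T.VQ)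
    (hloc : ∀ (i : Fin T.lstar) (vQ : T.VQ), P.qLocal (Cor312.Setting.labelSucc i) vQ =
      -(∑ v ∈ (vFbad_finite D).toFinset with g v = vQ, qTerm (E := E) v) / (2 * (l : ℝ) * Module.finrank ℚ F)) :
    P.negLogQ = -absLogq D := by
  have hsupp : Function.support (fun vQ : T.VQ =>
      -(∑ v ∈ (vFbad_finite D).toFinset with g v = vQ, qTerm (E := E) v) / (2 * (l : ℝ) * Module.finrank ℚ F))
        ⊆ ((vFbad_finite D).toFinset.image g : Set T.VQ) := by
    intro vQ hvQ
    rw [Function.mem_support] at hvQ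
    simp only [Finset.coe_image, Set.mem_image, Finset.mem_coe]
    by_contra hne
    apply hvQ
    have hempty : (vFbad_finite D).toFinset.filter (fun v => g v = vQ) = ∅ :=
      Finset.filter_eq_empty_iff.mpr fun v hv hgv => hne ⟨v, hv, hgv⟩
    rw [hempty, Finset.sum_empty, neg_zero, zero_div]
  have h1 : P.negLogQ = ∑ vQ ∈ (vFbad_finite D).toFinset.image g,
      -(∑ v ∈ (vFbad_finite D).toFinset with g v = vQ, qTerm (E := E) v) / (2 * (l : ℝ) * Module.finrank ℚ F) := by
    rw [P.negLogQ_eq_finsum_of_qLocal _ hloc, finsum_eq_sum_of_support_subset _ hsupp]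
  have h2 := logq_eq_sum_fiberwise D g
  rw [h1, absLogq, h2]
  simp only [neg_div, Finset.sum_neg_distrib, ← Finset.sum_div]
  ring

end Cor312Prov

end Summit.ABC.IUTFork

end
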